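import Mathlib
import HarnessLib

/-!
# LINE g21-A «shell separation» — rung R-S2c `OneSidedDeterminacy` BY NAME (⟨stmt-QuantumFields-23125⟩)

Crux `F4SubCurvatureDoor.RationalToGeneral` ⟨stmt-QuantumFields-23125⟩, skeleton `Cruxes/RationalToGeneral/Lines/shell_separation.lean`, owner
rung file `Cruxes/RationalToGeneral/Lines/shell_separation_rungs.lean` (ns `…Cruxes.RationalToGeneral.ShellSeparationRungs`).  This file restates
R-S2c `OneSidedDeterminacy` CHARACTER-IDENTICALLY and proves `oneSidedDeterminacy_holds : OneSidedDeterminacy`: two finite positive measures on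
`[0, ∞)` with an exponential-square-root moment `∫ e^{c√q} < ∞` and equal power moments are equal (determinacy of the Stieltjes moment problem
under Carleman-type integrability; step (3) of `stub_shellSeparation`).

PROOF (Mathlib's moment-generating-function machinery).  Push forward to `λ = ±√q`: the even finite measure `ν_σ = √_*σ + (-√)_*σ` on `ℝ` has
`(-c, c) ⊆ integrableExpSet id ν_σ`, so `complexMGF id ν_σ` is analytic on the strip `|Re z| < c`
(`ProbabilityTheory.analyticOnNhd_complexMGF`) with `n`-th derivative at `0` equal to `∫ λⁿ dν_σ` (`iteratedDeriv_complexMGF`), which is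
`2∫ q^{n/2} dσ` for even `n` (`(√q)² = q` `σ`-a.e.) and `0` for odd `n`; equal moments give equal Taylor coefficients, hence equality on the disc
`|z| < c` (`Complex.taylorSeries_eq_on_ball`), hence on the strip (identity theorem), hence equal characteristic functions
(`complexMGF_id_mul_I`), hence `ν_σ = ν_τ` (`Measure.ext_of_charFun`); pushing forward by `λ ↦ λ²` gives `σ + σ = τ + τ`, so `σ = τ`.

HONEST LABEL: a classical lemma, one rung of an OPEN line; the stubs `ForwardConeSupport` / `ShellSeparation` / `ShellFiniteType`, ⟨23125⟩, ⟨23035⟩,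
R2d and the Yang–Mills mass gap remain OPEN; no summit is proved by a line.
-/

noncomputable section

open MeasureTheory Filter Topology Set Metric Complex ProbabilityTheory
open scoped BigOperators NNReal ENNReal

namespace Summit.QuantumFields.YangMills.Theorems.F4SubCurvatureDoorOneSidedDeterminacyRegistered

/-- R-S2c «ONE-SIDED DETERMINACY» (M, Mathlib only): finite positive measures on `[0,∞)` with an `e^{c√q}`-moment and equal power moments
coincide. [problem-side rung; Akhiezer1965 Ch. 2 §5, Schmudgen2020 Lect. 4] -/
def OneSidedDeterminacy : Prop :=
  ∀ (σ τ : Measure ℝ) (c : ℝ), 0 < c → IsFiniteMeasure σ → IsFiniteMeasure τ →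
    σ (Set.Iio 0) = 0 → τ (Set.Iio 0) = 0 →
    Integrable (fun q : ℝ => Real.exp (c * Real.sqrt q)) σ →
    Integrable (fun q : ℝ => Real.exp (c * Real.sqrt q)) τ →
    (∀ k : ℕ, ∫ q, q ^ k ∂σ = ∫ q, q ^ k ∂τ) → σ = τ

/-! ## The even square-root lift -/

/-- A.e. nonnegativity from `σ(q < 0) = 0`. -/
theorem ae_nonneg_of_measure_Iio {σ : Measure ℝ} (h : σ (Set.Iio 0) = 0) : ∀ᵐ q ∂σ, 0 ≤ q := by
  rw [ae_iff]
  have e : {a : ℝ | ¬ 0 ≤ a} = Set.Iio 0 := by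
    ext a; simp [not_le]
  rw [e]; exact h

/-- Exponential integrability of `e^{tλ}` under the square-root pushforwards for `|t| ≤ c`. -/
theorem integrable_exp_mul_sqrt {σ : Measure ℝ} {c t : ℝ} (hσ : Integrable (fun q : ℝ => Real.exp (c * Real.sqrt q)) σ)
    (ht : |t| ≤ c) (ε : ℝ) (hε : ε = 1 ∨ ε = -1) :
    Integrable (fun q : ℝ => Real.exp (t * (ε * Real.sqrt q))) σ := by
  refine hσ.mono' (by fun_prop) (Eventually.of_forall fun q => ?_)
  rw [Real.norm_eq_abs, abs_of_pos (Real.exp_pos _)]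
  refine Real.exp_le_exp.2 ?_
  have hs : 0 ≤ Real.sqrt q := Real.sqrt_nonneg q
  have h1 : t * (ε * Real.sqrt q) ≤ |t| * Real.sqrt q := by
    rcases hε with h | h
    · rw [h, one_mul]; exact le_trans (le_abs_self _) (le_of_eq (abs_mul t _ ▸ by rw [abs_of_nonneg hs]))
    · rw [h, neg_one_mul, mul_neg]
      exact le_trans (neg_le_abs _) (le_of_eq (by rw [abs_mul, abs_of_nonneg hs]))
  exact h1.trans (mul_le_mul_of_nonneg_right ht hs)

/-- **The even square-root lift and its moments.**  For a finite measure `σ` on `[0,∞)` with `∫e^{c√q}dσ < ∞` let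
`ν = √_*σ + (-√)_*σ`.  Then `ν` is finite, the strip `|Re z| < c` lies in the analyticity domain of `complexMGF id ν`, and the `n`-th
derivative of `complexMGF id ν` at `0` is `2∫ q^{n/2} dσ` for even `n` and `0` for odd `n`. -/
theorem sqrtLift_moments (σ : Measure ℝ) [IsFiniteMeasure σ] {c : ℝ} (hc : 0 < c) (hσ0 : σ (Set.Iio 0) = 0)
    (hσ : Integrable (fun q : ℝ => Real.exp (c * Real.sqrt q)) σ) :
    (∀ t : ℝ, |t| < c → t ∈ interior (integrableExpSet id (σ.map Real.sqrt + σ.map (fun q => -Real.sqrt q)))) ∧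
    (∀ n : ℕ, iteratedDeriv n (complexMGF id (σ.map Real.sqrt + σ.map (fun q => -Real.sqrt q))) 0
        = if Even n then (((2 * ∫ q, q ^ (n / 2) ∂σ : ℝ)) : ℂ) else 0) := by
  set ν : Measure ℝ := σ.map Real.sqrt + σ.map (fun q => -Real.sqrt q) with hν
  have hms : Measurable Real.sqrt := Real.continuous_sqrt.measurable
  have hmn : Measurable fun q : ℝ => -Real.sqrt q := Real.continuous_sqrt.measurable.neg
  -- exponential integrability on the strip
  have hexp : ∀ t : ℝ, |t| ≤ c → Integrable (fun s : ℝ => Real.exp (t * id s)) ν := by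
    intro t ht
    rw [hν, integrable_add_measure]
    constructor
    · refine (integrable_map_measure (by fun_prop) hms.aemeasurable).2 ?_
      have := integrable_exp_mul_sqrt hσ ht 1 (Or.inl rfl)
      simpa [Function.comp_def] using this
    · refine (integrable_map_measure (by fun_prop) hmn.aemeasurable).2 ?_
      have := integrable_exp_mul_sqrt hσ ht (-1) (Or.inr rfl)
      simpa [Function.comp_def] using this
  have hsub : Ioo (-c) c ⊆ integrableExpSet id ν := fun t ht => hexp t (abs_lt.2 ⟨ht.1, ht.2⟩).le
  have hint : ∀ t : ℝ, |t| < c → t ∈ interior (integrableExpSet id ν) := fun t ht =>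
    (isOpen_Ioo.subset_interior_iff.2 hsub) (abs_lt.1 ht)
  refine ⟨hint, fun n => ?_⟩
  rw [iteratedDeriv_complexMGF (hint 0 (by rw [abs_zero]; exact hc)) n]
  simp only [id_eq, zero_mul, Complex.exp_zero, mul_one]
  rw [show (∫ x : ℝ, (x : ℂ) ^ n ∂ν) = ((∫ x : ℝ, x ^ n ∂ν : ℝ) : ℂ) by
    rw [← integral_complex_ofReal]; push_cast; rfl]
  -- integrability of the powers under both pushforwards
  have hc2 : c / 2 ≠ 0 := by positivity
  have hpow1 : Integrable (fun q : ℝ => Real.sqrt q ^ n) σ := by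
    have h := integrable_pow_of_integrable_exp_mul (μ := σ) (X := fun q => Real.sqrt q) hc2
      (by simpa using integrable_exp_mul_sqrt hσ (by rw [abs_of_pos (half_pos hc)]; linarith) 1 (Or.inl rfl))
      (by simpa [neg_mul] using integrable_exp_mul_sqrt hσ (by rw [abs_of_pos (half_pos hc)]; linarith) (-1) (Or.inr rfl)) n
    exact h
  have hpow2 : Integrable (fun q : ℝ => (-Real.sqrt q) ^ n) σ := by
    rcases Nat.even_or_odd n with he | ho
    · simpa [he.neg_pow] using hpow1
    · simpa [ho.neg_pow] using hpow1.neg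
  have h1 : Integrable (fun s : ℝ => s ^ n) (σ.map Real.sqrt) :=
    (integrable_map_measure (by fun_prop) hms.aemeasurable).2 (by simpa [Function.comp_def] using hpow1)
  have h2 : Integrable (fun s : ℝ => s ^ n) (σ.map fun q => -Real.sqrt q) :=
    (integrable_map_measure (by fun_prop) hmn.aemeasurable).2 (by simpa [Function.comp_def] using hpow2)
  rw [hν, integral_add_measure h1 h2, integral_map hms.aemeasurable (by fun_prop), integral_map hmn.aemeasurable (by fun_prop)]
  have hae := ae_nonneg_of_measure_Iio hσ0
  rcases Nat.even_or_odd n with he | ho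
  · rw [if_pos he]
    obtain ⟨k, hk⟩ := he
    have hk2 : n / 2 = k := by omega
    have e1 : ∫ q, Real.sqrt q ^ n ∂σ = ∫ q, q ^ (n / 2) ∂σ := by
      refine integral_congr_ae ?_
      filter_upwards [hae] with q hq
      rw [hk2, hk, ← two_mul, pow_mul, Real.sq_sqrt hq]
    have e2 : ∫ q, (-Real.sqrt q) ^ n ∂σ = ∫ q, q ^ (n / 2) ∂σ := by
      refine integral_congr_ae ?_
      filter_upwards [hae] with q hq
      rw [hk2, hk, ← two_mul, pow_mul, neg_sq, Real.sq_sqrt hq]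
    rw [e1, e2]
    push_cast; ring
  · rw [if_neg (Nat.not_even_iff_odd.2 ho)]
    have e2 : ∫ q, (-Real.sqrt q) ^ n ∂σ = -∫ q, Real.sqrt q ^ n ∂σ := by
      rw [← integral_neg]
      refine integral_congr_ae (Eventually.of_forall fun q => ?_)
      simp [ho.neg_pow]
    rw [e2, add_neg_cancel]
    simp

/-- The square pushforward of the lift recovers `σ + σ`. -/
theorem map_sq_sqrtLift (σ : Measure ℝ) (hσ0 : σ (Set.Iio 0) = 0) :
    (σ.map Real.sqrt + σ.map (fun q => -Real.sqrt q)).map (fun s : ℝ => s ^ 2) = σ + σ := by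
  have hms : Measurable Real.sqrt := Real.continuous_sqrt.measurable
  have hmn : Measurable fun q : ℝ => -Real.sqrt q := Real.continuous_sqrt.measurable.neg
  have hsq : Measurable fun s : ℝ => s ^ 2 := by fun_prop
  have hae := ae_nonneg_of_measure_Iio hσ0
  rw [Measure.map_add _ _ hsq, Measure.map_map hsq hms, Measure.map_map hsq hmn]
  have e1 : ((fun s : ℝ => s ^ 2) ∘ Real.sqrt) =ᵐ[σ] id := by
    filter_upwards [hae] with q hq
    simp [Real.sq_sqrt hq]
  have e2 : ((fun s : ℝ => s ^ 2) ∘ fun q => -Real.sqrt q) =ᵐ[σ] id := by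
    filter_upwards [hae] with q hq
    simp [Real.sq_sqrt hq]
  rw [Measure.map_congr e1, Measure.map_congr e2, Measure.map_id]

/-! ## The rung -/

/-- **RUNG R-S2c (by name): `OneSidedDeterminacy`.** -/
theorem oneSidedDeterminacy_holds : OneSidedDeterminacy := by
  intro σ τ c hc hσfin hτfin hσ0 hτ0 hσ hτ hmom
  set νσ : Measure ℝ := σ.map Real.sqrt + σ.map (fun q => -Real.sqrt q) with hνσ
  set ντ : Measure ℝ := τ.map Real.sqrt + τ.map (fun q => -Real.sqrt q) with hντ
  haveI : IsFiniteMeasure νσ := by rw [hνσ]; infer_instance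
  haveI : IsFiniteMeasure ντ := by rw [hντ]; infer_instance
  obtain ⟨hintσ, hderσ⟩ := sqrtLift_moments σ hc hσ0 hσ
  obtain ⟨hintτ, hderτ⟩ := sqrtLift_moments τ hc hτ0 hτ
  -- equal Taylor coefficients at 0
  have hder : ∀ n : ℕ, iteratedDeriv n (complexMGF id νσ) 0 = iteratedDeriv n (complexMGF id ντ) 0 := by
    intro n
    rw [hderσ n, hderτ n]
    split_ifs with h
    · rw [hmom (n / 2)]
    · rfl
  -- the strip and analyticity
  set S : Set ℂ := {z : ℂ | z.re ∈ Ioo (-c) c} with hS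
  have hSσ : S ⊆ {z : ℂ | z.re ∈ interior (integrableExpSet id νσ)} := fun z hz => hintσ z.re (abs_lt.2 hz)
  have hSτ : S ⊆ {z : ℂ | z.re ∈ interior (integrableExpSet id ντ)} := fun z hz => hintτ z.re (abs_lt.2 hz)
  have hfa : AnalyticOnNhd ℂ (complexMGF id νσ) S := analyticOnNhd_complexMGF.mono hSσ
  have hga : AnalyticOnNhd ℂ (complexMGF id ντ) S := analyticOnNhd_complexMGF.mono hSτ
  have hball : ball (0 : ℂ) c ⊆ S := by
    intro z hz
    rw [mem_ball, dist_zero_right] at hz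
    have := Complex.abs_re_le_norm z
    exact abs_lt.1 (lt_of_le_of_lt this hz)
  -- equality on the disc `|z| < c` by Taylor expansion at 0
  have hdisc : ∀ z ∈ ball (0 : ℂ) c, complexMGF id νσ z = complexMGF id ντ z := by
    intro z hz
    have hf := Complex.taylorSeries_eq_on_ball ((hfa.mono hball).differentiableOn) hz
    have hg := Complex.taylorSeries_eq_on_ball ((hga.mono hball).differentiableOn) hz
    rw [← hf, ← hg]
    exact tsum_congr fun n => by rw [hder n]
  -- identity theorem on the strip
  have hconv : Convex ℝ S := (convex_Ioo (-c) c).linear_preimage Complex.reLm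
  have h0S : (0 : ℂ) ∈ S := by simp [hS, hc]
  have hev : complexMGF id νσ =ᶠ[𝓝 0] complexMGF id ντ :=
    Filter.eventually_of_mem (Metric.ball_mem_nhds 0 hc) hdisc
  have hstrip := hfa.eqOn_of_preconnected_of_eventuallyEq hga hconv.isPreconnected h0S hev
  -- equal characteristic functions, equal lifts
  have hchar : charFun νσ = charFun ντ := by
    funext t
    rw [← complexMGF_id_mul_I, ← complexMGF_id_mul_I]
    exact hstrip (by simp [hS, hc])
  have hν : νσ = ντ := Measure.ext_of_charFun hchar
  -- pull back by `λ ↦ λ²`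
  have h2 : σ + σ = τ + τ := by
    rw [← map_sq_sqrtLift σ hσ0, ← map_sq_sqrtLift τ hτ0]
    exact congrArg _ hν
  ext s hs
  have h3 := congrArg (fun m : Measure ℝ => m s) h2
  simp only [Measure.add_apply] at h3
  rw [← two_mul, ← two_mul] at h3
  exact (ENNReal.mul_right_inj two_ne_zero ENNReal.ofNat_ne_top).1 h3

end Summit.QuantumFields.YangMills.Theorems.F4SubCurvatureDoorOneSidedDeterminacyRegistered

end
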